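import Summits.QuantumFields.YangMills.Theorems.BalabanUVNodesK0AxComplexGaussianRatioBudget

/-!
# K0 axis — the complex Gaussian ratio AT THE RECORD: (F-coer), (F-im-e), (F-int) FROM PER-PIECE, s-FREE LETTERS (the (E3)∕(P5ᶜ) currency)

LANDING NOTE (porter ▶ PTC-1 g4, 2026-08-31; AUTHORSHIP = ◇ lens-1 g13 «cauchy-analytic», HOME file `nodeO-cover/LENS-1g13-ComplexGaussianRatioPieces-v3.lean` sha16 41056355636d90f5 · 331 l. · 19
thm · 0 def (CANDIDATE 7′ = CGRS FILE №7 v3: the PIECES reading — `quadC_finset_sum`, `quadC_eq_quadC_block`, ★`re_quadC_sum_ge_of_blocks` ((P1)∕(F-coer) FROM PER-CUBE LETTERS: block-supported,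
blockwise γ₀-coercive pieces ⇒ `γ₀Σx² ≤ Re quadC(Σ_q A_q) x` for any block map), and the end-to-end rates re-keyed on piece-level letters: ★★★`norm_decDiffList_recordFluctRatioC_le_of_pieces`,
★★`norm_recordFluctRatioC_sub_one_le_of_pieces`; farm evidence = ◇'s monolith v3 `nodeO-cover/evidence/LENS-1g13-CGR-TailHoloRecordRateBudgetPieces-monolith-check-v3.lean` 2ea9b7e20f2670ce rc 0 ·
0 warn · 0 sorry, axioms standard ×19): landed VERBATIM + this paragraph under ◇'s basename `…Theorems/BalabanUVNodesK0AxComplexGaussianRatioPieces.lean` (ns `…Theorems.K0AxComplexGaussianRatio`),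
one import `…K0AxComplexGaussianRatioBudget` (INTENT-85, landed just before), as INTENT-87; `--supports stmt-QuantumFields-27930 --as helper --cite Balaban1987RG1 --cite Balaban1988RG2Cluster
--cite Brydges1986` (NO `--workitem`; kind proof). ◆ CRIT-1's cut: ◆ CRIT-1 g39 «(B) CUT ◇ №7 v3 `…K0AxComplexGaussianRatioPieces` (41056355) — SAME-WALL: pushes the `s ∈ cpoly R'` quantifier
through DEF-1's ✓`recordSWeight` once (`‖recordSWeight s Y‖ ≤ R^{#cubes(Y)}`, single-cube weights real), so the displayed letters become s-FREE PER-PIECE ((P1) γ₀-coercivity of the s = 0 form,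
(P2) multi-cube form bounds via `re_quadC_sum_ge_of_blocks`∕`re_quadC_piecesFormC_ge_of_pieces`, (P3) Frobenius letter for real pieces, (P4) exponent of pieces form) ending in
`norm_decDiffList_recordFluctRatioC_le_of_pieces` — a genuine reduction step at the same wall (Schur test + block coercivity), not a tautology ⇒ SURVIVES, priced «(P1)–(P4) inhabited NOWHERE;
whether print's `{…}_rec` exponent HAS pieces form w.r.t. `recordSWeight` is ◆ (R-b) stage 2 — the file says so itself»; located-A = №6 + ✓`recordSWeight`∕`intCubes`∕`piecesFormC` ∧ located-B =
(E3)∕(P5ᶜ) per-piece letters (displayed); J1′: filters and `R ^ card`, `1 ≤ R` guards explicit; (P1)–(P4) jointly satisfiable — non-vacuous; no `Finset.sup ∅`∕ℕ-subtraction∕division junk; J4 BY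
NAME 0∕19 (controls `intCubes` 219, `recordSWeight` 55); BY STATEMENT: `quadC_finset_sum` EXTENDS ✓`…Tail.quadC_add` (not a twin), the Schur test `norm_quadC_le_of_row_col_sum` has no
K0Ax∕K0Record twin — no rider; customs-before-landing: CHAIN probe `scratch/Crit1Cut7_BudgetPieces_chain.lean` fafa4350f0b2550b · 838 l. = №6 v1a ⊕ №7 v3 body ⊕ 35 std-axiom guards ⇒ farm rc 0 · 0
warn · 0 sorry, 35∕35 std ⇒ №7 v3: GO VERBATIM (after №6; same flags)» (nodeO STATUS 2026-08-31T16:05:13Z). HONEST (porter): Mathlib linear algebra on DEF-1's typed vocabulary; the per-cube MODEL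
letters ((P1) blockwise coercivity, (F-int), (F-im-e)) are displayed hypotheses inhabited NOWHERE; the bridge to print's (2.12)–(2.13) is ◆ (R-b) stage 2; nothing of Bałaban asserted, ported,
discharged or refuted; `stub_FE`∕`stub_P0C` and ⟨27930⟩ OPEN; K0⁷ 20541 ∕ K0ᴬ 27238 ∕ K1ᴬ ∕ K3ᴬ OPEN — NOTHING of them proved; NODE O 0∕1; COUNT 8∕28 · K 1∕4 UNMOVED; finite 𝕋⁴ at fixed ε — NOT
continuum ∕ OS ∕ Clay; the Yang–Mills mass gap is NOT proved by any of this.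

LENS-1 (ideator 1, g13) companion file №7 (`Summits/QuantumFields/YangMills/Theorems/BalabanUVNodesK0AxComplexGaussianRatioPieces.lean`, namespace `…Theorems.K0AxComplexGaussianRatio`),
importing file №6 `…Budget`.  PURPOSE.  After №6 the N4-R interface is (F-coer) ∕ (F-int) ∕ (F-im-e), each still quantified over the COMPLEX decoupling parameters `s ∈ cpoly R'`.  This file
pushes the `s`-dependence through DEF-1's record weights ✓`recordSWeight` (`= 1` on single-cube pieces, the cube monomial `Π_{q ∈ intCubes Y} s_q` on multi-cube pieces) ONCE AND FOR ALL, so that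
what remains displayed is a list of **s-FREE, PER-PIECE letters** about the pieces `T_Y(ψ)` and about an exponent of pieces form `E = Σ_Y s^Y·e_Y` — exactly the currency of the model hands'
(E3)∕(P5ᶜ) letters (single-cube coercivity `γ₀`; multi-cube form∕row-sum bounds `θ_Y` weighted by `R'^{#cubes(Y)}`; entry sizes; sup bounds of the `e_Y` on `supp χ_rem`).
* §21 `‖Π_{q∈Q} s_q‖ ≤ R^{|Q|}`, `‖recordSWeight s Y‖ ≤ R^{#cubes(Y)}` on `cpoly R` (`1 ≤ R`), single-cube weights are real;
* §22 `quadC` of a pieces form is the weighted sum of the pieces' forms; the SPLIT `q_{M(s)} = q_{M(0)} + Σ_{multi} s^Y·q_{T_Y}`; the SCHUR TEST `‖quadC M x‖ ≤ ρ·Σx²` from row- AND column-ℓ¹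
  bounds `ρ`; ★★ **(F-coer) from letters**: `(γ₀ − Θ)·Σx² ≤ Re quadC M(s) x` on `cpoly R` from `γ₀`-coercivity of `M(0)` + `‖q_{T_Y}‖ ≤ θ_Y·Σx²` (multi-cube `Y`) + `Σ_{multi} R^{#cubes(Y)}θ_Y ≤ Θ`;
* §23 (real pieces) `Im M(s)_{ij} = Σ_{multi} Im(s^Y)·T_{Y,ij}`, `|Im M(s)_{ij}| ≤ Σ_{multi} R^{#cubes(Y)}‖T_{Y,ij}‖`, ★★ **(F-im-e) from letters** (Frobenius form);
* §24 (exponent of pieces form `E g s ψ x = Σ_Y recordSWeight s Y · e_Y x`): measurability, ENTIRE along coordinate lines, `‖E‖ ≤ Σ_Y R^{#cubes(Y)}ζ_Y` from `‖e_Y‖ ≤ ζ_Y`, hence `Re E ≤ η`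
  and `‖e^E − 1‖ ≤ 2η` (`η ≤ 1`) — ★★ **(F-int) from letters**;
* §25 ★★★ **`norm_decDiffList_recordFluctRatioC_le_of_pieces`** — the END-TO-END (1.18)-shaped Cauchy rate `‖Δ_{y₁}⋯Δ_{y_n} recordFluctRatioC (s)‖ ≤ e^{η+τ∕4}·e^{−κ₁ d}` whose displayed
  hypotheses are ONLY: (P1) `γ₀`-coercivity of the `s = 0` (single-cube) form; (P2) multi-cube form bounds with `Σ_{multi} R'^{#cubes}θ_Y ≤ Θ < γ₀`; (P3) real pieces with the Frobenius letter
  `Σ_{ij}(Σ_{multi} R'^{#cubes}‖T_{Y,ij}‖)² ≤ (γ₀−Θ)²τ`; (P4) `E` of pieces form, `e_Y` measurable, `‖e_Y‖ ≤ ζ_Y` on `supp χ_rem`, `Σ_Y R'^{#cubes}ζ_Y ≤ η` — NO quantifier over `s` left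
  except the point `s ∈ cpoly(1+e^{κ₁})` at which the difference is taken.
HONEST: finite-dimensional algebra∕calculus about DEF-1's VOCABULARY; (P1)–(P4) are NOT inhabited here (they are the hands' (E3)∕(P5ᶜ) letters, with (E3″) the standing number); whether print's
`{…}_rec` exponent HAS pieces form w.r.t. `recordSWeight` is part of ◆ (R-b), stage 2 (if it has not, §24–§25 simply do not apply and §22–§23 + file №6 remain the interface); `stub_FE`∕
`stub_P0C`∕⟨27930⟩∕K0⁷∕K0ᴬ OPEN; NODE O 0∕1; finite 𝕋⁴ at fixed ε — NOT continuum∕OS; **the Yang–Mills mass gap (Clay) is NOT proved here.**  No `sorry`; no new `Prop` letters; no instances.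
-/

noncomputable section

open scoped BigOperators Topology
open MeasureTheory Complex Metric Set Function
open Summit.QuantumFields.YangMills.Theorems.K0RecordFormatNames
open Summit.QuantumFields.YangMills.Theorems.K0AxCauchyDecoupling (cpoly SepHolOff BddOnPoly decDiffList norm_decDiffList_le_exp_of_le_length)
open Literature.MathematicalPhysics.QuantumFieldTheory.Balaban1983to89.T4Continuum (T4Family)

namespace Summit.QuantumFields.YangMills.Theorems.K0AxComplexGaussianRatio

variable (F : T4Family)

/-! ## §21  Size of the record weights on a polydisc -/

/-- `‖Π_{q ∈ Q} s_q‖ ≤ R^{|Q|}` for `s ∈ cpoly R`. [cite: Balaban1988RG2Cluster, (1.9)–(1.10) p.4 (bookkeeping)] -/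
theorem norm_cubeMonomial_le {R : ℝ} {s : (Fin 4 → ℤ) → ℂ} (hs : s ∈ cpoly (ι := Fin 4 → ℤ) R) (Q : Finset (Fin 4 → ℤ)) :
    ‖cubeMonomial s Q‖ ≤ R ^ Q.card := by
  unfold cubeMonomial
  rw [norm_prod, ← Finset.prod_const]
  exact Finset.prod_le_prod (fun q _ => norm_nonneg _) fun q _ => hs q

/-- `‖recordSWeight s Y‖ ≤ R^{#cubes(Y)}` for `s ∈ cpoly R`, `1 ≤ R`. [cite: Balaban1988RG2Cluster, (1.9)–(1.10) p.4 (bookkeeping)] -/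
theorem norm_recordSWeight_le (Mc k K : ℕ) {R : ℝ} (hR : 1 ≤ R) {s : (Fin 4 → ℤ) → ℂ} (hs : s ∈ cpoly (ι := Fin 4 → ℤ) R)
    (Y : (recordDomSys F Mc k K).Dom) : ‖recordSWeight F Mc k K s Y‖ ≤ R ^ (intCubes F Mc k K Y).card := by
  unfold recordSWeight
  split_ifs with h
  · rw [norm_one]; exact one_le_pow₀ hR
  · exact norm_cubeMonomial_le hs _

/-- Single-cube pieces carry the REAL weight `1`. [cite: Balaban1988RG2Cluster, (1.9) p.4 (bookkeeping)] -/
theorem im_recordSWeight_eq_zero_of_card_le_one (Mc k K : ℕ) (s : (Fin 4 → ℤ) → ℂ) (Y : (recordDomSys F Mc k K).Dom)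
    (h : (intCubes F Mc k K Y).card ≤ 1) : (recordSWeight F Mc k K s Y).im = 0 := by
  rw [recordSWeight_of_card_le_one F Mc k K s Y h, Complex.one_im]

/-! ## §22  The form of a pieces form; the split at the record weights; the Schur test; (F-coer) from per-piece letters -/

/-- `quadC (Σ_Y w_Y T_Y) x = Σ_Y w_Y · quadC T_Y x`. [cite: Balaban1987RG1, (2.11)–(2.12) pp.267–268 (bookkeeping)] -/
theorem quadC_piecesFormC {D Ψ : Type*} [Fintype D] (k K : ℕ) (T : D → Ψ → FluctIdx F k K → FluctIdx F k K → ℂ) (w : D → ℂ) (ψ : Ψ)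
    (x : NonB0Idx F k K → ℝ) :
    quadC (piecesFormC F k K T w ψ) x = ∑ Y, w Y * quadC (fun i j : NonB0Idx F k K => T Y ψ i.1 j.1) x := by
  calc quadC (piecesFormC F k K T w ψ) x = ∑ i, ∑ j, ∑ Y, w Y * ((x i : ℂ) * T Y ψ i.1 j.1 * (x j : ℂ)) := by
        simp only [quadC, piecesFormC, Finset.mul_sum, Finset.sum_mul]
        exact Finset.sum_congr rfl fun i _ => Finset.sum_congr rfl fun j _ => Finset.sum_congr rfl fun Y _ => by ring
    _ = ∑ i, ∑ Y, ∑ j, w Y * ((x i : ℂ) * T Y ψ i.1 j.1 * (x j : ℂ)) := Finset.sum_congr rfl fun i _ => Finset.sum_comm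
    _ = ∑ Y, ∑ i, ∑ j, w Y * ((x i : ℂ) * T Y ψ i.1 j.1 * (x j : ℂ)) := Finset.sum_comm
    _ = ∑ Y, w Y * quadC (fun i j : NonB0Idx F k K => T Y ψ i.1 j.1) x := by simp only [quadC, Finset.mul_sum]

/-- ★ **THE SPLIT AT THE RECORD WEIGHTS**: `q_{M(s)}(x) = q_{M(0)}(x) + Σ_{multi-cube Y} s^Y·q_{T_Y}(x)` (`M(0)` = the single-cube part ✓`piecesFormC_recordSWeight_zero`).
[cite: Balaban1988RG2Cluster, (1.9)–(1.10) p.4] -/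
theorem quadC_piecesFormC_recordSWeight_eq {Ψ : Type*} (Mc k K : ℕ) (T : (recordDomSys F Mc k K).Dom → Ψ → FluctIdx F k K → FluctIdx F k K → ℂ) (ψ : Ψ)
    (s : (Fin 4 → ℤ) → ℂ) (x : NonB0Idx F k K → ℝ) :
    quadC (piecesFormC F k K T (recordSWeight F Mc k K s) ψ) x
      = quadC (piecesFormC F k K T (recordSWeight F Mc k K (fun _ => 0)) ψ) x
        + ∑ Y ∈ Finset.univ.filter (fun Y => ¬ (intCubes F Mc k K Y).card ≤ 1),
            recordSWeight F Mc k K s Y * quadC (fun i j : NonB0Idx F k K => T Y ψ i.1 j.1) x := by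
  rw [quadC_piecesFormC, quadC_piecesFormC, Finset.sum_filter, ← Finset.sum_add_distrib]
  refine Finset.sum_congr rfl fun Y _ => ?_
  rw [recordSWeight_zero]
  by_cases h : (intCubes F Mc k K Y).card ≤ 1
  · simp [h, recordSWeight_of_card_le_one F Mc k K s Y h]
  · simp [h]

section Schur

variable {ι : Type*} [Fintype ι]

/-- ★ **SCHUR TEST** for the complex form at real points: row- and column-ℓ¹ bounds `ρ` give `‖quadC M x‖ ≤ ρ·Σx²`. [cite: Balaban1988RG2Cluster, (1.9)–(1.10) p.4 (bookkeeping)] -/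
theorem norm_quadC_le_of_row_col_sum (M : Matrix ι ι ℂ) {ρ : ℝ} (hrow : ∀ i, ∑ j, ‖M i j‖ ≤ ρ) (hcol : ∀ j, ∑ i, ‖M i j‖ ≤ ρ) (x : ι → ℝ) :
    ‖quadC M x‖ ≤ ρ * ∑ i, x i ^ 2 := by
  have hterm : ∀ i j, ‖(x i : ℂ) * M i j * (x j : ℂ)‖ ≤ ‖M i j‖ * (x i ^ 2 / 2) + ‖M i j‖ * (x j ^ 2 / 2) := fun i j => by
    rw [norm_mul, norm_mul, Complex.norm_real, Complex.norm_real, Real.norm_eq_abs, Real.norm_eq_abs]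
    nlinarith [sq_nonneg (|x i| - |x j|), sq_abs (x i), sq_abs (x j), norm_nonneg (M i j), abs_nonneg (x i), abs_nonneg (x j)]
  unfold quadC
  refine (norm_sum_le _ _).trans ((Finset.sum_le_sum fun i _ => norm_sum_le _ _).trans ?_)
  refine (Finset.sum_le_sum fun i _ => Finset.sum_le_sum fun j _ => hterm i j).trans ?_
  rw [Finset.sum_congr rfl fun i _ => Finset.sum_add_distrib, Finset.sum_add_distrib]
  have h1 : ∑ i, ∑ j, ‖M i j‖ * (x i ^ 2 / 2) ≤ ρ * ∑ i, x i ^ 2 / 2 := by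
    rw [Finset.mul_sum]
    refine Finset.sum_le_sum fun i _ => ?_
    rw [← Finset.sum_mul]
    have : 0 ≤ x i ^ 2 / 2 := by positivity
    exact mul_le_mul_of_nonneg_right (hrow i) this
  have h2 : ∑ i, ∑ j, ‖M i j‖ * (x j ^ 2 / 2) ≤ ρ * ∑ j, x j ^ 2 / 2 := by
    rw [Finset.sum_comm, Finset.mul_sum]
    refine Finset.sum_le_sum fun j _ => ?_
    rw [← Finset.sum_mul]
    have : 0 ≤ x j ^ 2 / 2 := by positivity
    exact mul_le_mul_of_nonneg_right (hcol j) this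
  have h3 : ρ * ∑ i, x i ^ 2 / 2 + ρ * ∑ j, x j ^ 2 / 2 = ρ * ∑ i, x i ^ 2 := by
    rw [← mul_add, ← Finset.sum_add_distrib]
    congr 1
    exact Finset.sum_congr rfl fun i _ => by ring
  linarith

end Schur

section Blocks

variable {ι κ : Type*} [Fintype ι] [Fintype κ]

/-- `quadC` is additive over finite sums of matrices. [cite: Balaban1987RG1, (2.11)–(2.12) pp.267–268 (bookkeeping)] -/
theorem quadC_finset_sum (A : κ → Matrix ι ι ℂ) (x : ι → ℝ) : quadC (∑ q, A q) x = ∑ q, quadC (A q) x := by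
  calc quadC (∑ q, A q) x = ∑ i, ∑ j, ∑ q, (x i : ℂ) * A q i j * (x j : ℂ) := by
        simp only [quadC, Matrix.sum_apply, Finset.mul_sum, Finset.sum_mul]
    _ = ∑ i, ∑ q, ∑ j, (x i : ℂ) * A q i j * (x j : ℂ) := Finset.sum_congr rfl fun i _ => Finset.sum_comm
    _ = ∑ q, ∑ i, ∑ j, (x i : ℂ) * A q i j * (x j : ℂ) := Finset.sum_comm
    _ = ∑ q, quadC (A q) x := by simp only [quadC]

omit [Fintype κ] in
/-- A form supported on the block `π = q` only sees the block part of `x`. [cite: Balaban1987RG1, (2.11)–(2.12) pp.267–268 (bookkeeping)] -/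
theorem quadC_eq_quadC_block [DecidableEq κ] (π : ι → κ) (q : κ) (B : Matrix ι ι ℂ) (hsupp : ∀ i j, (π i ≠ q ∨ π j ≠ q) → B i j = 0) (x : ι → ℝ) :
    quadC B x = quadC B (fun i => if π i = q then x i else 0) := by
  unfold quadC
  refine Finset.sum_congr rfl fun i _ => Finset.sum_congr rfl fun j _ => ?_
  by_cases hi : π i = q
  · by_cases hj : π j = q
    · simp [hi, hj]
    · simp [hsupp i j (Or.inr hj)]
  · simp [hsupp i j (Or.inl hi)]

/-- ★ **BLOCK COERCIVITY ⇒ COERCIVITY** (the (P1) letter from PER-CUBE letters): if `M = Σ_q A_q` with `A_q` supported on the block `{π = q}²` and `γ₀`-coercive on vectors supported in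
`{π = q}`, then `γ₀·Σx² ≤ Re quadC M x` for all `x`. [cite: Balaban1987RG1, (2.12) p.268; Balaban1988RG2Cluster, (1.9)–(1.10) p.4 (the `s = 0` block structure)] -/
theorem re_quadC_sum_ge_of_blocks [DecidableEq κ] (π : ι → κ) (A : κ → Matrix ι ι ℂ) {γ₀ : ℝ}
    (hsupp : ∀ q i j, (π i ≠ q ∨ π j ≠ q) → A q i j = 0)
    (hcoer : ∀ q (x : ι → ℝ), (∀ i, π i ≠ q → x i = 0) → γ₀ * ∑ i, x i ^ 2 ≤ (quadC (A q) x).re) (x : ι → ℝ) :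
    γ₀ * ∑ i, x i ^ 2 ≤ (quadC (∑ q, A q) x).re := by
  rw [quadC_finset_sum, Complex.re_sum]
  have hblock : ∀ q, γ₀ * ∑ i, (if π i = q then x i else 0) ^ 2 ≤ (quadC (A q) x).re := fun q => by
    rw [quadC_eq_quadC_block π q (A q) (hsupp q) x]
    exact hcoer q _ fun i hi => by simp [hi]
  have hsum : ∑ q, ∑ i, (if π i = q then x i else 0) ^ 2 = ∑ i, x i ^ 2 := by
    rw [Finset.sum_comm]
    refine Finset.sum_congr rfl fun i _ => ?_
    rw [Finset.sum_eq_single (π i) (fun q _ hq => by simp [Ne.symm hq]) (fun h => (h (Finset.mem_univ _)).elim)]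
    simp
  calc γ₀ * ∑ i, x i ^ 2 = ∑ q, γ₀ * ∑ i, (if π i = q then x i else 0) ^ 2 := by rw [← Finset.mul_sum, hsum]
    _ ≤ ∑ q, (quadC (A q) x).re := Finset.sum_le_sum fun q _ => hblock q

end Blocks

/-- ★★ **(F-coer) FROM PER-PIECE LETTERS**, uniformly on `cpoly R` (`1 ≤ R`): `(γ₀ − Θ)·Σx² ≤ Re quadC M(s) x` from `γ₀`-coercivity of the single-cube part `M(0)`, form bounds
`‖q_{T_Y}(x)‖ ≤ θ_Y·Σx²` on multi-cube pieces and the weighted sum `Σ_{multi} R^{#cubes(Y)}·θ_Y ≤ Θ` ((E3″)'s shape: `θ_Y` decays like `e^{−δ₀ d(Y)}` against `R^{#cubes} = e^{κ₁ #cubes}`).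
[cite: Balaban1988RG2Cluster, (1.9)–(1.10) p.4, (1.16) p.6; Balaban1987RG1, (2.12) p.268] -/
theorem re_quadC_piecesFormC_ge_of_pieces {Ψ : Type*} (Mc k K : ℕ) (T : (recordDomSys F Mc k K).Dom → Ψ → FluctIdx F k K → FluctIdx F k K → ℂ) (ψ : Ψ)
    {R γ₀ Θ : ℝ} (hR : 1 ≤ R)
    (hsingle : ∀ x : NonB0Idx F k K → ℝ, γ₀ * ∑ i, x i ^ 2 ≤ (quadC (piecesFormC F k K T (recordSWeight F Mc k K (fun _ => 0)) ψ) x).re)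
    (θ : (recordDomSys F Mc k K).Dom → ℝ)
    (hmulti : ∀ Y, ¬ (intCubes F Mc k K Y).card ≤ 1 → ∀ x : NonB0Idx F k K → ℝ, ‖quadC (fun i j : NonB0Idx F k K => T Y ψ i.1 j.1) x‖ ≤ θ Y * ∑ i, x i ^ 2)
    (hsum : ∑ Y ∈ Finset.univ.filter (fun Y => ¬ (intCubes F Mc k K Y).card ≤ 1), R ^ (intCubes F Mc k K Y).card * θ Y ≤ Θ)
    {s : (Fin 4 → ℤ) → ℂ} (hs : s ∈ cpoly (ι := Fin 4 → ℤ) R) (x : NonB0Idx F k K → ℝ) :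
    (γ₀ - Θ) * ∑ i, x i ^ 2 ≤ (quadC (piecesFormC F k K T (recordSWeight F Mc k K s) ψ) x).re := by
  rw [quadC_piecesFormC_recordSWeight_eq, Complex.add_re, Complex.re_sum]
  have hx0 : 0 ≤ ∑ i, x i ^ 2 := Finset.sum_nonneg fun i _ => sq_nonneg _
  have hterm : ∀ Y ∈ Finset.univ.filter (fun Y => ¬ (intCubes F Mc k K Y).card ≤ 1),
      -(R ^ (intCubes F Mc k K Y).card * θ Y * ∑ i, x i ^ 2)
        ≤ (recordSWeight F Mc k K s Y * quadC (fun i j : NonB0Idx F k K => T Y ψ i.1 j.1) x).re := by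
    intro Y hY
    have hY' := (Finset.mem_filter.mp hY).2
    have h1 : ‖recordSWeight F Mc k K s Y * quadC (fun i j : NonB0Idx F k K => T Y ψ i.1 j.1) x‖
        ≤ R ^ (intCubes F Mc k K Y).card * θ Y * ∑ i, x i ^ 2 := by
      rw [norm_mul, mul_assoc]
      exact mul_le_mul (norm_recordSWeight_le F Mc k K hR hs Y) (hmulti Y hY' x) (norm_nonneg _) (pow_nonneg (by linarith) _)
    exact neg_le_of_abs_le ((Complex.abs_re_le_norm _).trans h1)
  have hS : -(Θ * ∑ i, x i ^ 2) ≤ ∑ Y ∈ Finset.univ.filter (fun Y => ¬ (intCubes F Mc k K Y).card ≤ 1),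
      (recordSWeight F Mc k K s Y * quadC (fun i j : NonB0Idx F k K => T Y ψ i.1 j.1) x).re := by
    refine le_trans ?_ (Finset.sum_le_sum hterm)
    rw [Finset.sum_neg_distrib, neg_le_neg_iff, ← Finset.sum_mul]
    exact mul_le_mul_of_nonneg_right hsum hx0
  have h0 := hsingle x
  linarith

/-! ## §23  (F-im-e) from per-piece letters (real pieces: the imaginary part comes only from the multi-cube weights) -/

/-- `Im M(s)_{ij} = Σ_{multi} Im(s^Y)·Re T_{Y,ij}` for real pieces. [cite: Balaban1988RG2Cluster, (1.9)–(1.10) p.4] -/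
theorem im_piecesFormC_recordSWeight_eq {Ψ : Type*} (Mc k K : ℕ) (T : (recordDomSys F Mc k K).Dom → Ψ → FluctIdx F k K → FluctIdx F k K → ℂ) (ψ : Ψ)
    (hTreal : ∀ Y i j, (T Y ψ i j).im = 0) (s : (Fin 4 → ℤ) → ℂ) (i j : NonB0Idx F k K) :
    (piecesFormC F k K T (recordSWeight F Mc k K s) ψ i j).im
      = ∑ Y ∈ Finset.univ.filter (fun Y => ¬ (intCubes F Mc k K Y).card ≤ 1), (recordSWeight F Mc k K s Y).im * (T Y ψ i.1 j.1).re := by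
  simp only [piecesFormC, Complex.im_sum, Complex.mul_im, hTreal, mul_zero, zero_add]
  rw [Finset.sum_filter]
  refine Finset.sum_congr rfl fun Y _ => ?_
  by_cases h : (intCubes F Mc k K Y).card ≤ 1
  · simp [h, im_recordSWeight_eq_zero_of_card_le_one F Mc k K s Y h]
  · simp [h]

/-- `|Im M(s)_{ij}| ≤ Σ_{multi} R^{#cubes(Y)}·‖T_{Y,ij}‖` on `cpoly R` (real pieces). [cite: Balaban1988RG2Cluster, (1.9)–(1.10) p.4] -/
theorem abs_im_piecesFormC_recordSWeight_le {Ψ : Type*} (Mc k K : ℕ) (T : (recordDomSys F Mc k K).Dom → Ψ → FluctIdx F k K → FluctIdx F k K → ℂ) (ψ : Ψ)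
    (hTreal : ∀ Y i j, (T Y ψ i j).im = 0) {R : ℝ} (hR : 1 ≤ R) {s : (Fin 4 → ℤ) → ℂ} (hs : s ∈ cpoly (ι := Fin 4 → ℤ) R) (i j : NonB0Idx F k K) :
    |(piecesFormC F k K T (recordSWeight F Mc k K s) ψ i j).im|
      ≤ ∑ Y ∈ Finset.univ.filter (fun Y => ¬ (intCubes F Mc k K Y).card ≤ 1), R ^ (intCubes F Mc k K Y).card * ‖T Y ψ i.1 j.1‖ := by
  rw [im_piecesFormC_recordSWeight_eq F Mc k K T ψ hTreal]
  refine (Finset.abs_sum_le_sum_abs _ _).trans (Finset.sum_le_sum fun Y _ => ?_)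
  rw [abs_mul]
  exact mul_le_mul ((Complex.abs_im_le_norm _).trans (norm_recordSWeight_le F Mc k K hR hs Y)) (Complex.abs_re_le_norm _)
    (abs_nonneg _) (pow_nonneg (by linarith) _)

/-- ★★ **(F-im-e) FROM PER-PIECE LETTERS** (Frobenius form, real pieces): `‖Im M(s)‖_F² ≤ Σ_{ij}(Σ_{multi} R^{#cubes(Y)}‖T_{Y,ij}‖)²` on `cpoly R`.
[cite: Balaban1988RG2Cluster, (1.9)–(1.10) p.4, (1.16) p.6] -/
theorem sum_sq_im_piecesFormC_recordSWeight_le {Ψ : Type*} (Mc k K : ℕ) (T : (recordDomSys F Mc k K).Dom → Ψ → FluctIdx F k K → FluctIdx F k K → ℂ) (ψ : Ψ)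
    (hTreal : ∀ Y i j, (T Y ψ i j).im = 0) {R : ℝ} (hR : 1 ≤ R) {s : (Fin 4 → ℤ) → ℂ} (hs : s ∈ cpoly (ι := Fin 4 → ℤ) R) :
    ∑ i, ∑ j, ((piecesFormC F k K T (recordSWeight F Mc k K s) ψ) i j).im ^ 2
      ≤ ∑ i : NonB0Idx F k K, ∑ j : NonB0Idx F k K,
          (∑ Y ∈ Finset.univ.filter (fun Y => ¬ (intCubes F Mc k K Y).card ≤ 1), R ^ (intCubes F Mc k K Y).card * ‖T Y ψ i.1 j.1‖) ^ 2 :=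
  Finset.sum_le_sum fun i _ => Finset.sum_le_sum fun j _ => by
    have h := abs_im_piecesFormC_recordSWeight_le F Mc k K T ψ hTreal hR hs i j
    exact sq_le_sq' (neg_le_of_abs_le h) (le_of_abs_le h)

/-! ## §24  (F-int) from per-piece letters: an exponent of pieces form `E g s ψ x = Σ_Y recordSWeight s Y · e_Y x` -/

/-- Measurability in `x`. [cite: Balaban1987RG1, (2.12)–(2.13) p.268 (bookkeeping)] -/
theorem measurable_E_of_pieces {Ψ : Type*} (Mc k K : ℕ) (E : ℝ → ((Fin 4 → ℤ) → ℂ) → Ψ → (NonB0Idx F k K → ℝ) → ℂ) (g : ℝ) (ψ : Ψ)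
    (e : (recordDomSys F Mc k K).Dom → (NonB0Idx F k K → ℝ) → ℂ) (hEp : ∀ s x, E g s ψ x = ∑ Y, recordSWeight F Mc k K s Y * e Y x)
    (he : ∀ Y, Measurable (e Y)) (s : (Fin 4 → ℤ) → ℂ) : Measurable (E g s ψ) := by
  have h : E g s ψ = fun x => ∑ Y, recordSWeight F Mc k K s Y * e Y x := funext (hEp s)
  rw [h]
  exact Finset.measurable_sum _ fun Y _ => (he Y).const_mul _

/-- ENTIRE along every coordinate line of the decoupling parameters. [cite: Balaban1988RG2Cluster, (1.9)–(1.10) p.4 (bookkeeping)] -/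
theorem differentiable_E_update_of_pieces {Ψ : Type*} (Mc k K : ℕ) (E : ℝ → ((Fin 4 → ℤ) → ℂ) → Ψ → (NonB0Idx F k K → ℝ) → ℂ) (g : ℝ) (ψ : Ψ)
    (e : (recordDomSys F Mc k K).Dom → (NonB0Idx F k K → ℝ) → ℂ) (hEp : ∀ s x, E g s ψ x = ∑ Y, recordSWeight F Mc k K s Y * e Y x)
    (s : (Fin 4 → ℤ) → ℂ) (y : Fin 4 → ℤ) (x : NonB0Idx F k K → ℝ) :
    Differentiable ℂ (fun t : ℂ => E g (update s y t) ψ x) := by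
  simp only [hEp]
  exact Differentiable.fun_sum fun Y _ => (differentiable_recordSWeight_update F Mc k K s y Y).mul_const _

/-- `‖E g s ψ x‖ ≤ Σ_Y R^{#cubes(Y)}·ζ_Y` on `cpoly R` from `‖e_Y x‖ ≤ ζ_Y`. [cite: Balaban1987RG1, (2.12)–(2.13) p.268; Balaban1988RG2Cluster, (1.16) p.6 (shape)] -/
theorem norm_E_le_of_pieces {Ψ : Type*} (Mc k K : ℕ) (E : ℝ → ((Fin 4 → ℤ) → ℂ) → Ψ → (NonB0Idx F k K → ℝ) → ℂ) (g : ℝ) (ψ : Ψ)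
    (e : (recordDomSys F Mc k K).Dom → (NonB0Idx F k K → ℝ) → ℂ) (hEp : ∀ s x, E g s ψ x = ∑ Y, recordSWeight F Mc k K s Y * e Y x)
    {R : ℝ} (hR : 1 ≤ R) {s : (Fin 4 → ℤ) → ℂ} (hs : s ∈ cpoly (ι := Fin 4 → ℤ) R) (ζ : (recordDomSys F Mc k K).Dom → ℝ)
    (x : NonB0Idx F k K → ℝ) (he : ∀ Y, ‖e Y x‖ ≤ ζ Y) :
    ‖E g s ψ x‖ ≤ ∑ Y, R ^ (intCubes F Mc k K Y).card * ζ Y := by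
  rw [hEp]
  refine (norm_sum_le _ _).trans (Finset.sum_le_sum fun Y _ => ?_)
  rw [norm_mul]
  exact mul_le_mul (norm_recordSWeight_le F Mc k K hR hs Y) (he Y) (norm_nonneg _) (pow_nonneg (by linarith) _)

/-- `‖e^{E} − 1‖ ≤ 2η` once `‖E‖ ≤ η ≤ 1` (the (F-int) smallness for the `|R − 1|` clause). [cite: Balaban1987RG1, (2.19) p.270 (bookkeeping)] -/
theorem norm_exp_E_sub_one_le_of_pieces {Ψ : Type*} (Mc k K : ℕ) (E : ℝ → ((Fin 4 → ℤ) → ℂ) → Ψ → (NonB0Idx F k K → ℝ) → ℂ) (g : ℝ) (ψ : Ψ)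
    (e : (recordDomSys F Mc k K).Dom → (NonB0Idx F k K → ℝ) → ℂ) (hEp : ∀ s x, E g s ψ x = ∑ Y, recordSWeight F Mc k K s Y * e Y x)
    {R : ℝ} (hR : 1 ≤ R) {s : (Fin 4 → ℤ) → ℂ} (hs : s ∈ cpoly (ι := Fin 4 → ℤ) R) (ζ : (recordDomSys F Mc k K).Dom → ℝ)
    (x : NonB0Idx F k K → ℝ) (he : ∀ Y, ‖e Y x‖ ≤ ζ Y) {η : ℝ} (hη : ∑ Y, R ^ (intCubes F Mc k K Y).card * ζ Y ≤ η) (hη1 : η ≤ 1) :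
    ‖cexp (E g s ψ x) - 1‖ ≤ 2 * η := by
  have h := (norm_E_le_of_pieces F Mc k K E g ψ e hEp hR hs ζ x he).trans hη
  exact (Complex.norm_exp_sub_one_le (h.trans hη1)).trans (by linarith)

/-! ## §25  END TO END from per-piece, s-FREE letters -/

/-- ★★★ **THE (1.18)-SHAPED CAUCHY RATE FROM PER-PIECE LETTERS**: `‖Δ_{y₁}⋯Δ_{y_n} recordFluctRatioC (s)‖ ≤ e^{η + τ∕4}·e^{−κ₁ d}` (`d ≤ n`, distinct `y`'s, `s ∈ cpoly(1+e^{κ₁})`,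
`1 + e^{κ₁} < R'`), displayed hypotheses ONLY: (P1) `γ₀·Σx² ≤ Re q_{M(0)}(x)` (single-cube part); (P2) `‖q_{T_Y}(x)‖ ≤ θ_Y·Σx²` on multi-cube pieces, `Σ_{multi} R'^{#cubes(Y)}θ_Y ≤ Θ < γ₀`;
(P3) real pieces, `Σ_{ij}(Σ_{multi} R'^{#cubes(Y)}‖T_{Y,ij}‖)² ≤ (γ₀ − Θ)²·τ`; (P4) `E g s ψ x = Σ_Y recordSWeight s Y·e_Y x` with `e_Y` measurable, `‖e_Y x‖ ≤ ζ_Y` on `supp χ_rem`,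
`Σ_Y R'^{#cubes(Y)}ζ_Y ≤ η`.  [cite: Balaban1988RG2Cluster, (1.8)–(1.10) p.3–5, (1.16) p.6, (1.18) p.7, (2.30) p.18 (shape; locators); Balaban1987RG1, (2.12)–(2.13) p.268; Brydges1986, Part III §2 (locator)] -/
theorem norm_decDiffList_recordFluctRatioC_le_of_pieces {Ψ : Type*} (Mc k K : ℕ) (ε₁ : ℝ)
    (T : (recordDomSys F Mc k K).Dom → Ψ → FluctIdx F k K → FluctIdx F k K → ℂ) (E : ℝ → ((Fin 4 → ℤ) → ℂ) → Ψ → (NonB0Idx F k K → ℝ) → ℂ) (g : ℝ) (ψ : Ψ)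
    {κ₁ R' γ₀ Θ : ℝ} (hκ0 : 0 ≤ κ₁) (hR' : 1 + Real.exp κ₁ < R') (hΘ : Θ < γ₀) (η τ : ℝ)
    (hsingle : ∀ x : NonB0Idx F k K → ℝ, γ₀ * ∑ i, x i ^ 2 ≤ (quadC (piecesFormC F k K T (recordSWeight F Mc k K (fun _ => 0)) ψ) x).re)
    (θ : (recordDomSys F Mc k K).Dom → ℝ)
    (hmulti : ∀ Y, ¬ (intCubes F Mc k K Y).card ≤ 1 → ∀ x : NonB0Idx F k K → ℝ, ‖quadC (fun i j : NonB0Idx F k K => T Y ψ i.1 j.1) x‖ ≤ θ Y * ∑ i, x i ^ 2)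
    (hsum : ∑ Y ∈ Finset.univ.filter (fun Y => ¬ (intCubes F Mc k K Y).card ≤ 1), R' ^ (intCubes F Mc k K Y).card * θ Y ≤ Θ)
    (hTreal : ∀ Y i j, (T Y ψ i j).im = 0)
    (hT2 : ∑ i : NonB0Idx F k K, ∑ j : NonB0Idx F k K,
      (∑ Y ∈ Finset.univ.filter (fun Y => ¬ (intCubes F Mc k K Y).card ≤ 1), R' ^ (intCubes F Mc k K Y).card * ‖T Y ψ i.1 j.1‖) ^ 2 ≤ (γ₀ - Θ) ^ 2 * τ)
    (e : (recordDomSys F Mc k K).Dom → (NonB0Idx F k K → ℝ) → ℂ) (hEp : ∀ s x, E g s ψ x = ∑ Y, recordSWeight F Mc k K s Y * e Y x)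
    (he : ∀ Y, Measurable (e Y)) (ζ : (recordDomSys F Mc k K).Dom → ℝ) (heζ : ∀ Y x, chiRem F k K ε₁ x ≠ 0 → ‖e Y x‖ ≤ ζ Y)
    (hη : ∑ Y, R' ^ (intCubes F Mc k K Y).card * ζ Y ≤ η)
    {l : List (Fin 4 → ℤ)} (hl : l.Nodup) {s : (Fin 4 → ℤ) → ℂ} (hs : s ∈ cpoly (ι := Fin 4 → ℤ) (1 + Real.exp κ₁)) {d : ℝ} (hd : d ≤ l.length) :
    ‖decDiffList l (fun s => recordFluctRatioC F Mc k K ε₁ T E g s ψ) s‖ ≤ Real.exp (η + (1 / 4 : ℝ) * τ) * Real.exp (-κ₁ * d) := by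
  have hR'1 : (1 : ℝ) ≤ R' := by linarith [Real.exp_pos κ₁]
  refine norm_decDiffList_recordFluctRatioC_le_of_sum_sq_im F Mc k K ε₁ T E g ψ hκ0 hR' (a := γ₀ - Θ) (by linarith) η τ
    (fun s hs x => re_quadC_piecesFormC_ge_of_pieces F Mc k K T ψ hR'1 hsingle θ hmulti hsum hs x)
    (fun s _ => measurable_E_of_pieces F Mc k K E g ψ e hEp he s)
    (fun s _ y x _ => (differentiable_E_update_of_pieces F Mc k K E g ψ e hEp s y x).differentiableOn)
    (fun s hs x hx => (Complex.re_le_norm _).trans ((norm_E_le_of_pieces F Mc k K E g ψ e hEp hR'1 hs ζ x fun Y => heζ Y x hx).trans hη))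
    (fun s hs => (sum_sq_im_piecesFormC_recordSWeight_le F Mc k K T ψ hTreal hR'1 (cpoly_mono hR'.le hs)).trans hT2) hl hs hd

/-- ★★ **THE `|c| = 1` CLAUSE FROM PER-PIECE LETTERS**: `‖recordFluctRatioC(s) − 1‖ ≤ e^{τ∕4}·(2η + 2|ι|·e^{−(γ₀−Θ)r²∕2})` at `s ∈ cpoly R` (`1 ≤ R`, `√3·r < ε₁`, `η ≤ 1`) from (P1), (P2),
(P3) `Σ_{ij}(Σ_{multi} R^{#cubes(Y)}‖T_{Y,ij}‖)² ≤ (γ₀−Θ)²τ` and (P4) (`e_Y` measurable, `‖e_Y x‖ ≤ ζ_Y` on `supp χ_rem`, `Σ_Y R^{#cubes(Y)}ζ_Y ≤ η ≤ 1`).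
[cite: Balaban1987RG1, (2.9) p.266, (2.12)+(2.19) p.268–270; Balaban1988RG2Cluster, (1.9)–(1.10) p.4, (1.16) p.6] -/
theorem norm_recordFluctRatioC_sub_one_le_of_pieces {Ψ : Type*} (Mc k K : ℕ) (ε₁ : ℝ)
    (T : (recordDomSys F Mc k K).Dom → Ψ → FluctIdx F k K → FluctIdx F k K → ℂ) (E : ℝ → ((Fin 4 → ℤ) → ℂ) → Ψ → (NonB0Idx F k K → ℝ) → ℂ) (g : ℝ) (ψ : Ψ)
    {R γ₀ Θ : ℝ} (hR : 1 ≤ R) (hΘ : Θ < γ₀) {η τ r : ℝ} (hη0 : 0 ≤ η) (hη1 : η ≤ 1) (hr : 0 ≤ r) (hrε : Real.sqrt 3 * r < ε₁)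
    (hsingle : ∀ x : NonB0Idx F k K → ℝ, γ₀ * ∑ i, x i ^ 2 ≤ (quadC (piecesFormC F k K T (recordSWeight F Mc k K (fun _ => 0)) ψ) x).re)
    (θ : (recordDomSys F Mc k K).Dom → ℝ)
    (hmulti : ∀ Y, ¬ (intCubes F Mc k K Y).card ≤ 1 → ∀ x : NonB0Idx F k K → ℝ, ‖quadC (fun i j : NonB0Idx F k K => T Y ψ i.1 j.1) x‖ ≤ θ Y * ∑ i, x i ^ 2)
    (hsum : ∑ Y ∈ Finset.univ.filter (fun Y => ¬ (intCubes F Mc k K Y).card ≤ 1), R ^ (intCubes F Mc k K Y).card * θ Y ≤ Θ)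
    (hTreal : ∀ Y i j, (T Y ψ i j).im = 0)
    (hT2 : ∑ i : NonB0Idx F k K, ∑ j : NonB0Idx F k K,
      (∑ Y ∈ Finset.univ.filter (fun Y => ¬ (intCubes F Mc k K Y).card ≤ 1), R ^ (intCubes F Mc k K Y).card * ‖T Y ψ i.1 j.1‖) ^ 2 ≤ (γ₀ - Θ) ^ 2 * τ)
    (e : (recordDomSys F Mc k K).Dom → (NonB0Idx F k K → ℝ) → ℂ) (hEp : ∀ s x, E g s ψ x = ∑ Y, recordSWeight F Mc k K s Y * e Y x)
    (he : ∀ Y, Measurable (e Y)) (ζ : (recordDomSys F Mc k K).Dom → ℝ) (heζ : ∀ Y x, chiRem F k K ε₁ x ≠ 0 → ‖e Y x‖ ≤ ζ Y)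
    (hη : ∑ Y, R ^ (intCubes F Mc k K Y).card * ζ Y ≤ η)
    {s : (Fin 4 → ℤ) → ℂ} (hs : s ∈ cpoly (ι := Fin 4 → ℤ) R) :
    ‖recordFluctRatioC F Mc k K ε₁ T E g s ψ - 1‖
      ≤ Real.exp ((1 / 4 : ℝ) * τ) * (2 * η + 2 * (Fintype.card (NonB0Idx F k K) * Real.exp (-((γ₀ - Θ) * r ^ 2 / 2)))) := by
  have ha : 0 < γ₀ - Θ := by linarith
  have h := norm_recordFluctRatioC_sub_one_le_of_sum_sq_im F Mc k K ε₁ T E g ψ s ha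
    (re_quadC_piecesFormC_ge_of_pieces F Mc k K T ψ hR hsingle θ hmulti hsum hs)
    (measurable_E_of_pieces F Mc k K E g ψ e hEp he s) (η₁ := 2 * η) (by linarith) hr hrε
    (fun x hx => norm_exp_E_sub_one_le_of_pieces F Mc k K E g ψ e hEp hR hs ζ x (fun Y => heζ Y x hx) hη hη1)
    ((sum_sq_im_piecesFormC_recordSWeight_le F Mc k K T ψ hTreal hR hs).trans hT2)
  refine h.trans (mul_le_mul_of_nonneg_right (Real.exp_le_exp.mpr ?_) (by positivity))
  have : (γ₀ - Θ) ^ 2 * τ / (4 * (γ₀ - Θ) ^ 2) = (1 / 4 : ℝ) * τ := by field_simp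
  rw [this]

end Summit.QuantumFields.YangMills.Theorems.K0AxComplexGaussianRatio

end
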